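import Summits.BirchSwinnertonDyer.Rank1Residual.Additive.X4ThreeResCertRecords3
import Literature.NumberTheory.EllipticCurves.Wuthrich2014.ThreeAdicImageSupersingularProofs
import HarnessLib

/-!
# `X4ThreeResCertRecords3` WITHOUT the binder `hL20` (Wuthrich's Lemma 20 is a tree theorem): binder-free twins

HONEST FRAMING (cell `b2b-bsdres`, run/shared/lean/b2b/bsd-rank1-residual/, verbatim in every
file): the goal of the cell is to DELETE the COMBINATION-SHAPED residual classes of the
Birch–Swinnerton-Dyer formula for ALL analytic-rank `≤ 1` elliptic curves over `ℚ` — "full BSD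
formula for every rank `≤ 1` curve in class `C`" assembled STRICTLY from published theorems — so
that the rank-`≤ 1` remainder becomes exactly the CONSTRUCTION-SHAPED classes, which are TYPED
(missing-input `Prop`s), NOT attempted. This is not "finishing BSD". Team n1011 (N10 / N11), seat
p05, OWNERS row T-b1ss = the `hL20`-BINDER SWEEP on `Additive/` + `AdditivePotMult/`: Wuthrich's
Lemma 20 (registry A9, the named fact `Wuthrich2014.lemma20_surjective_threeAdic_of_semistable`: at a
prime-to-`9` conductor, `ρ̄_{E,3}` onto ⟹ `ρ̄_{E,3ⁿ}` onto for all `n`) is a tree THEOREM since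
2026-08-21 (`Wuthrich2014.lemma20_surjective_threeAdic_of_semistable_holds`, file
`Literature/NumberTheory/EllipticCurves/Wuthrich2014/ThreeAdicImageSupersingularProofs.lean`, units
lit-kato / n1011-p02), so every theorem of the cell carrying it as a hypothesis has a twin WITHOUT that
binder.  This file states those twins for the theorems of its sibling (suffix `_noL20`; statement =
the sibling's statement with the binder deleted, other hypotheses unchanged; proof = the sibling's
theorem fed with `_holds`).  No claim beyond the stated classes; labels UNCHANGED; nothing is booked.
Theorems only (no definition, no named fact minted).

## What this file proves

Binder-free twins (`_noL20`) of the 7 theorems of `Summits/BirchSwinnertonDyer/Rank1Residual/Additive/X4ThreeResCertRecords3.lean` that carry the hypothesis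
`(hL20 : Wuthrich2014.lemma20_surjective_threeAdic_of_semistable)`:
* `bsdp3_v8775h1_noL20`
* `bsdp3_v9747i1_noL20`
* `bsdp3_v10584bh1_noL20`
* `bsdp3_v10584bn1_noL20`
* `bsdp3_v10584h1_noL20`
* `bsdp3_v10584i1_noL20`
* `bsdp3_v10584v1_noL20`

References: [Wuthrich2014] C. Wuthrich, Doc. Math. 19 (2014) 381–402, Lemma 20 (p. 399); the
sibling's references for everything else.
-/

set_option autoImplicit false

noncomputable section

open scoped Classical

open WeierstrassCurve Literature.NumberTheory.EllipticCurves
  Literature.NumberTheory.EllipticCurves.ModularForms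
  Literature.NumberTheory.EllipticCurves.Rank1Residual
  Literature.NumberTheory.EllipticCurves.Rank1Residual.Typed
  Literature.NumberTheory.EllipticCurves.AgasheRibetStein2006
  Literature.NumberTheory.EllipticCurves.Rank1Residual.X11RankOneCertificates
  Summit.BirchSwinnertonDyer.BirchSwinnertonDyer.Rank1Residual.IntModel
  Summit.BirchSwinnertonDyer.BirchSwinnertonDyer.Rank1Residual.X11RankOne
  Summit.BirchSwinnertonDyer.Rank1Residual.GaloisImage

namespace Summit.BirchSwinnertonDyer.Rank1Residual.Additive.X4ThreeResCert

/-- **Binder-free twin of `bsdp3_v8775h1`** — the same statement WITHOUT the hypothesis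
`Wuthrich2014.lemma20_surjective_threeAdic_of_semistable` (Wuthrich 2014 Lemma 20 = registry A9, now the tree
theorem `…_holds`); proof = the original fed with `_holds`. [cite: Wuthrich2014, Lemma 20 (p. 399)] -/
theorem bsdp3_v8775h1_noL20
    (hKatoS : Kato2004.rankZero_padicValNat_sha_le_sub_localTamagawa_of_additive_potGood_of_imageContainsSL2)
    (hDel : Delbourgo1998.prop4_rankZero_pow_dvd_constantCoeff)
    (hGZK : rank_eq_analyticRank_of_analyticRank_le_one) (hmod : hasEntireLFunction_rat)
    (hmodD : nonempty_modularParametrizationData)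
    (hKatoχ : Wuthrich2014.kato_halfEigenCharIdeal_dvd_cyclotomicPrime_of_surjective)
    (h26 : cremona_abs_maninConstant_eq_one_of_level_le) (W : WeierstrassCurve ℚ)
    (hW : W = ⟨1, -1, 1, -71432930, 232396286572⟩) (hr : W.analyticRank = 0) {q : ℚ}
    (hq : shaAn W = (q : ℂ)) (hv : padicValRat 3 q = 0) (htam : ¬ 3 ∣ W.tamagawaProduct)
    (hopt : ∃ D : ModularParametrizationData W 8775,
      ∀ z ∈ D.L.lattice, ∃ w ∈ periodLattice D.f, z = D.c * w) :
    haveI : Fact (Nat.Prime 3) := ⟨Nat.prime_three⟩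
    BSDp W 3 :=
  bsdp3_v8775h1 hKatoS hDel hGZK hmod hmodD
    Wuthrich2014.lemma20_surjective_threeAdic_of_semistable_holds hKatoχ h26 W hW hr hq hv htam hopt

/-- **Binder-free twin of `bsdp3_v9747i1`** — the same statement WITHOUT the hypothesis
`Wuthrich2014.lemma20_surjective_threeAdic_of_semistable` (Wuthrich 2014 Lemma 20 = registry A9, now the tree
theorem `…_holds`); proof = the original fed with `_holds`. [cite: Wuthrich2014, Lemma 20 (p. 399)] -/
theorem bsdp3_v9747i1_noL20
    (hKatoS : Kato2004.rankZero_padicValNat_sha_le_sub_localTamagawa_of_additive_potGood_of_imageContainsSL2)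
    (hDel : Delbourgo1998.prop4_rankZero_pow_dvd_constantCoeff)
    (hGZK : rank_eq_analyticRank_of_analyticRank_le_one) (hmod : hasEntireLFunction_rat)
    (hmodD : nonempty_modularParametrizationData)
    (hKatoχ : Wuthrich2014.kato_halfEigenCharIdeal_dvd_cyclotomicPrime_of_surjective)
    (h26 : cremona_abs_maninConstant_eq_one_of_level_le) (W : WeierstrassCurve ℚ)
    (hW : W = ⟨0, 0, 1, -185193, 30788336⟩) (hr : W.analyticRank = 0) {q : ℚ}
    (hq : shaAn W = (q : ℂ)) (hv : padicValRat 3 q = 0) (htam : ¬ 3 ∣ W.tamagawaProduct)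
    (hopt : ∃ D : ModularParametrizationData W 9747,
      ∀ z ∈ D.L.lattice, ∃ w ∈ periodLattice D.f, z = D.c * w) :
    haveI : Fact (Nat.Prime 3) := ⟨Nat.prime_three⟩
    BSDp W 3 :=
  bsdp3_v9747i1 hKatoS hDel hGZK hmod hmodD
    Wuthrich2014.lemma20_surjective_threeAdic_of_semistable_holds hKatoχ h26 W hW hr hq hv htam hopt

/-- **Binder-free twin of `bsdp3_v10584bh1`** — the same statement WITHOUT the hypothesis
`Wuthrich2014.lemma20_surjective_threeAdic_of_semistable` (Wuthrich 2014 Lemma 20 = registry A9, now the tree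
theorem `…_holds`); proof = the original fed with `_holds`. [cite: Wuthrich2014, Lemma 20 (p. 399)] -/
theorem bsdp3_v10584bh1_noL20
    (hKatoS : Kato2004.rankZero_padicValNat_sha_le_sub_localTamagawa_of_additive_potGood_of_imageContainsSL2)
    (hDel : Delbourgo1998.prop4_rankZero_pow_dvd_constantCoeff)
    (hGZK : rank_eq_analyticRank_of_analyticRank_le_one) (hmod : hasEntireLFunction_rat)
    (hmodD : nonempty_modularParametrizationData)
    (hKatoχ : Wuthrich2014.kato_halfEigenCharIdeal_dvd_cyclotomicPrime_of_surjective)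
    (h26 : cremona_abs_maninConstant_eq_one_of_level_le) (W : WeierstrassCurve ℚ)
    (hW : W = ⟨0, 0, 0, -1323, -314874⟩) (hr : W.analyticRank = 0) {q : ℚ} (hq : shaAn W = (q : ℂ))
    (hv : padicValRat 3 q = 0) (htam : ¬ 3 ∣ W.tamagawaProduct)
    (hopt : ∃ D : ModularParametrizationData W 10584,
      ∀ z ∈ D.L.lattice, ∃ w ∈ periodLattice D.f, z = D.c * w) :
    haveI : Fact (Nat.Prime 3) := ⟨Nat.prime_three⟩
    BSDp W 3 :=
  bsdp3_v10584bh1 hKatoS hDel hGZK hmod hmodD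
    Wuthrich2014.lemma20_surjective_threeAdic_of_semistable_holds hKatoχ h26 W hW hr hq hv htam hopt

/-- **Binder-free twin of `bsdp3_v10584bn1`** — the same statement WITHOUT the hypothesis
`Wuthrich2014.lemma20_surjective_threeAdic_of_semistable` (Wuthrich 2014 Lemma 20 = registry A9, now the tree
theorem `…_holds`); proof = the original fed with `_holds`. [cite: Wuthrich2014, Lemma 20 (p. 399)] -/
theorem bsdp3_v10584bn1_noL20
    (hKatoS : Kato2004.rankZero_padicValNat_sha_le_sub_localTamagawa_of_additive_potGood_of_imageContainsSL2)
    (hDel : Delbourgo1998.prop4_rankZero_pow_dvd_constantCoeff)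
    (hGZK : rank_eq_analyticRank_of_analyticRank_le_one) (hmod : hasEntireLFunction_rat)
    (hmodD : nonempty_modularParametrizationData)
    (hKatoχ : Wuthrich2014.kato_halfEigenCharIdeal_dvd_cyclotomicPrime_of_surjective)
    (h26 : cremona_abs_maninConstant_eq_one_of_level_le) (W : WeierstrassCurve ℚ)
    (hW : W = ⟨0, 0, 0, -5292, 185220⟩) (hr : W.analyticRank = 0) {q : ℚ} (hq : shaAn W = (q : ℂ))
    (hv : padicValRat 3 q = 0) (htam : ¬ 3 ∣ W.tamagawaProduct)
    (hopt : ∃ D : ModularParametrizationData W 10584,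
      ∀ z ∈ D.L.lattice, ∃ w ∈ periodLattice D.f, z = D.c * w) :
    haveI : Fact (Nat.Prime 3) := ⟨Nat.prime_three⟩
    BSDp W 3 :=
  bsdp3_v10584bn1 hKatoS hDel hGZK hmod hmodD
    Wuthrich2014.lemma20_surjective_threeAdic_of_semistable_holds hKatoχ h26 W hW hr hq hv htam hopt

/-- **Binder-free twin of `bsdp3_v10584h1`** — the same statement WITHOUT the hypothesis
`Wuthrich2014.lemma20_surjective_threeAdic_of_semistable` (Wuthrich 2014 Lemma 20 = registry A9, now the tree
theorem `…_holds`); proof = the original fed with `_holds`. [cite: Wuthrich2014, Lemma 20 (p. 399)] -/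
theorem bsdp3_v10584h1_noL20
    (hKatoS : Kato2004.rankZero_padicValNat_sha_le_sub_localTamagawa_of_additive_potGood_of_imageContainsSL2)
    (hDel : Delbourgo1998.prop4_rankZero_pow_dvd_constantCoeff)
    (hGZK : rank_eq_analyticRank_of_analyticRank_le_one) (hmod : hasEntireLFunction_rat)
    (hmodD : nonempty_modularParametrizationData)
    (hKatoχ : Wuthrich2014.kato_halfEigenCharIdeal_dvd_cyclotomicPrime_of_surjective)
    (h26 : cremona_abs_maninConstant_eq_one_of_level_le) (W : WeierstrassCurve ℚ)
    (hW : W = ⟨0, 0, 0, -2139291, 1204356006⟩) (hr : W.analyticRank = 0) {q : ℚ}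
    (hq : shaAn W = (q : ℂ)) (hv : padicValRat 3 q = 0) (htam : ¬ 3 ∣ W.tamagawaProduct)
    (hopt : ∃ D : ModularParametrizationData W 10584,
      ∀ z ∈ D.L.lattice, ∃ w ∈ periodLattice D.f, z = D.c * w) :
    haveI : Fact (Nat.Prime 3) := ⟨Nat.prime_three⟩
    BSDp W 3 :=
  bsdp3_v10584h1 hKatoS hDel hGZK hmod hmodD
    Wuthrich2014.lemma20_surjective_threeAdic_of_semistable_holds hKatoχ h26 W hW hr hq hv htam hopt

/-- **Binder-free twin of `bsdp3_v10584i1`** — the same statement WITHOUT the hypothesis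
`Wuthrich2014.lemma20_surjective_threeAdic_of_semistable` (Wuthrich 2014 Lemma 20 = registry A9, now the tree
theorem `…_holds`); proof = the original fed with `_holds`. [cite: Wuthrich2014, Lemma 20 (p. 399)] -/
theorem bsdp3_v10584i1_noL20
    (hKatoS : Kato2004.rankZero_padicValNat_sha_le_sub_localTamagawa_of_additive_potGood_of_imageContainsSL2)
    (hDel : Delbourgo1998.prop4_rankZero_pow_dvd_constantCoeff)
    (hGZK : rank_eq_analyticRank_of_analyticRank_le_one) (hmod : hasEntireLFunction_rat)
    (hmodD : nonempty_modularParametrizationData)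
    (hKatoχ : Wuthrich2014.kato_halfEigenCharIdeal_dvd_cyclotomicPrime_of_surjective)
    (h26 : cremona_abs_maninConstant_eq_one_of_level_le) (W : WeierstrassCurve ℚ)
    (hW : W = ⟨0, 0, 0, 189, -1890⟩) (hr : W.analyticRank = 0) {q : ℚ} (hq : shaAn W = (q : ℂ))
    (hv : padicValRat 3 q = 0) (htam : ¬ 3 ∣ W.tamagawaProduct)
    (hopt : ∃ D : ModularParametrizationData W 10584,
      ∀ z ∈ D.L.lattice, ∃ w ∈ periodLattice D.f, z = D.c * w) :
    haveI : Fact (Nat.Prime 3) := ⟨Nat.prime_three⟩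
    BSDp W 3 :=
  bsdp3_v10584i1 hKatoS hDel hGZK hmod hmodD
    Wuthrich2014.lemma20_surjective_threeAdic_of_semistable_holds hKatoχ h26 W hW hr hq hv htam hopt

/-- **Binder-free twin of `bsdp3_v10584v1`** — the same statement WITHOUT the hypothesis
`Wuthrich2014.lemma20_surjective_threeAdic_of_semistable` (Wuthrich 2014 Lemma 20 = registry A9, now the tree
theorem `…_holds`); proof = the original fed with `_holds`. [cite: Wuthrich2014, Lemma 20 (p. 399)] -/
theorem bsdp3_v10584v1_noL20
    (hKatoS : Kato2004.rankZero_padicValNat_sha_le_sub_localTamagawa_of_additive_potGood_of_imageContainsSL2)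
    (hDel : Delbourgo1998.prop4_rankZero_pow_dvd_constantCoeff)
    (hGZK : rank_eq_analyticRank_of_analyticRank_le_one) (hmod : hasEntireLFunction_rat)
    (hmodD : nonempty_modularParametrizationData)
    (hKatoχ : Wuthrich2014.kato_halfEigenCharIdeal_dvd_cyclotomicPrime_of_surjective)
    (h26 : cremona_abs_maninConstant_eq_one_of_level_le) (W : WeierstrassCurve ℚ)
    (hW : W = ⟨0, 0, 0, -18522, 972405⟩) (hr : W.analyticRank = 0) {q : ℚ} (hq : shaAn W = (q : ℂ))
    (hv : padicValRat 3 q = 0) (htam : ¬ 3 ∣ W.tamagawaProduct)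
    (hopt : ∃ D : ModularParametrizationData W 10584,
      ∀ z ∈ D.L.lattice, ∃ w ∈ periodLattice D.f, z = D.c * w) :
    haveI : Fact (Nat.Prime 3) := ⟨Nat.prime_three⟩
    BSDp W 3 :=
  bsdp3_v10584v1 hKatoS hDel hGZK hmod hmodD
    Wuthrich2014.lemma20_surjective_threeAdic_of_semistable_holds hKatoχ h26 W hW hr hq hv htam hopt

end Summit.BirchSwinnertonDyer.Rank1Residual.Additive.X4ThreeResCert

end
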